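/-
Copyright (c) 2026 the pub-hodgecm-mathlib formalisation cell (harness21).  Prover seat hodgecm-mathlib-K2Liu-p08 (g3): Track B «K2-LIT»,
hLiu418 = stmt-HodgeConjecture-24832; LEAD F0P6-plan (g13) RULINGS «M-157o» (S5-W1) ∕ «M-157p» (4) ∕ 10:10:36Z, file S5-W1-fin (the closer:
W1-fin-a ⊕ W1-fin-b).
-/
import Summits.HodgeConjecture.HodgeConjecture.Theorems.K2LiuRankOneLocalSWValueAtZeroWord    -- ★ W1-fin-b (value-at-zero word)
import Summits.HodgeConjecture.HodgeConjecture.Theorems.K2LiuOscillatoryBallLocalisation      -- ★ W1-fin-a (ball-averaged oscillatory integrals)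
import HarnessLib

-- buildfix G11b-3 recipe (LEDGER B13-1/B13-3), as in the GelbartRogawski1991 siblings: elaborate sequentially.
set_option Elab.async false

/-!
# Crux `HLiu418`, road `K2_Liu`, #42S-S5 «incoherent pieces die», file S5-W1-fin (closer):
# THE BALL-AVERAGED LOCAL WHITTAKER VALUE OF THE SW SECTION OF A LINE DIES OFF THE ORBIT

Cell `hodgecm-mathlib`, crux item hLiu418 = `stmt-HodgeConjecture-24832`; squad K2 ∕ K2Liu; prover K2Liu-p08 (g3).  THEOREMS ONLY (no `def`, no
instance, no notation, no named-fact hypothesis, no `sorry`); lane `--supports stmt-HodgeConjecture-24832 --as helper` (count-neutral helper).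

THE STATEMENT (RULING M-157o (i), «the `(N₁,ψ_h)`-functional on the SW image of a LINE at the centre is the orbital integral over `{⟨x,x⟩_v = h}`, hence `0`
when `a_v` does not represent `h`»), in the bad-place currency of record (LD2's standard doubled line twisted section `σ`, ★ W1-fin-b; ★ Φ5's BALL form of
the local Whittaker coefficient, Karel): for the Schrödinger-model datum of a hermitian line at a finite place `v` (mover `E″`, implementer `Γ`, Weyl matrix `B′`,
skew parameter `τ`, unipotent form `c_τ`), a test vector `Ψ`, a Whittaker parameter `β′ ∈ L⁺_v`, and compact open subgroups `C k ↑ L⁺_v`: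
  IF the quadratic form `q = halfForm c_τ` does NOT take the value `β′` on the support of `ΓΨ`,
  THEN **`∫_{b ∈ C k} (Γ(σ(w₁·n(b·τ))Ψ))(0) · ψ_v(β′ b) dμ(b) = 0` for all large `k`** (`exists_forall_setIntegral_valueAtZero_mul_addChar_eq_zero`).
PROOF = ★ W1-fin-b (`(Γ(σ(w₁ n(bτ))Ψ))(0) = γ·∫ leviOpPi B′ (unipOpPi (b•c_τ)(ΓΨ))`, ONE `γ` for all `b`) makes the `b`-integrand `γ·∫_x Φ̃(x)·θ_x(b) dx` with
`Φ̃ = |det B′|^{−1∕2}·(ΓΨ)∘B′⁻¹` (continuous, compactly supported) and the additive character `θ_x = ψ_v((β′ − q(B′⁻¹x))·)` (★ `coe_leviOpPi_apply`,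
★ `coe_unipOpPi_apply`, `halfForm (b•c) = b·halfForm c`); `θ_x` is non-trivial exactly where `q(B′⁻¹x) ≠ β′`, i.e. on all of `tsupport Φ̃` by hypothesis, so
★ W1-fin-a `exists_forall_setIntegral_integral_mul_addChar_eq_zero` kills the ball average.  §1 is the GENERIC analytic closer (any Schrödinger-model word
`V(b) = γ·∫(leviOpPi a (unipOpPi (b•c) g))`, no CM telescope); §2 instantiates it at the twisted section (★ W1-fin-b).  The consumer (S5-F3, K2Liu-p13; S5-F2's
`hbad`, K2Liu-p01) reads Φ5's `t = (b·τ)·1 ∈ Skew₁`, `ψ_v(−τ′tr(β t)) = ψ_v(β′ b)` and Karel's ball-independence (★ `whittaker_setIntegral_ball_eq`).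
HONEST LABEL.  `HC_CM` is proved only modulo the 7 printed citations (2 remaining named inputs: hLiu418 = `stmt-HodgeConjecture-24832`,
h413 = `stmt-HodgeConjecture-24833`) until rung 0 closes.

## References
* [KudlaRallis1994] S. Kudla, S. Rallis, Ann. of Math. 140 (1994), §2 (Whittaker functionals of `ω(·)Φ(0)` are orbital integrals).
* [MoeglinVignerasWaldspurger1987] C. Mœglin, M.-F. Vignéras, J.-L. Waldspurger, LNM 1291 (1987), Chap. 2 II.6, Chap. 3 IV.
* [Rangarao1993] R. Ranga Rao, Pacific J. Math. 157 (1993), Lemma 3.2 (3.8) (`unipOpPi`, `leviOpPi`).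
* [JiangWu2016ChiB] D. Jiang, C. Wu, J. Number Theory 161 (2016), Prop. 4.1.
-/

set_option autoImplicit false
set_option linter.dupNamespace false -- the mandated namespace repeats `HodgeConjecture.HodgeConjecture`

noncomputable section

open scoped Matrix Kronecker Topology
open NumberField IsDedekindDomain MeasureTheory MeasureTheory.Measure Matrix Set Filter
open Literature.NumberTheory Literature.NumberTheory.Automorphic Literature.NumberTheory.Automorphic.UnitaryGroup
open Literature.RepresentationTheory Literature.RepresentationTheory.HeisenbergGroup Literature.RepresentationTheory.TwistedCoinv
open Literature.RepresentationTheory.HeisenbergGroup.SymplecticMatrix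
open Literature.NumberTheory.GelbartRogawski1991 Literature.NumberTheory.GelbartRogawski1991.UnitaryDualPair
open Literature.NumberTheory.GelbartRogawski1991.UnitaryDualPair.WeilCoinv
open Literature.NumberTheory.GelbartRogawski1991.UnitaryDualPair.LocalSplitting
open Literature.NumberTheory.Weil1964
open Literature.NumberTheory.GaloisRepresentations Literature.NumberTheory.GaloisRepresentations.IsNonarchimedeanLocalField
open Literature.RepresentationTheory.HarrisKudlaSweet1996
open Literature.RepresentationTheory.MoeglinVignerasWaldspurger1987
open Summit.HodgeConjecture.HodgeConjecture.Cruxes.HLiu418.K2LiuOscillatoryBallLocalisation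
open Summit.HodgeConjecture.HodgeConjecture.Cruxes.HLiu418.K2LiuRankOneLocalSWValueAtZeroWord

namespace Summit.HodgeConjecture.HodgeConjecture.Cruxes.HLiu418.K2LiuRankOneLocalSWWhittakerVanishing

/-! ## §1 The generic analytic closer: a Schrödinger-model word `V(b) = γ·∫ leviOpPi a (unipOpPi (b•c) g)` dies under ball averaging off the orbit -/

section Generic

variable {F : Type} [Field F] [ValuativeRel F] [TopologicalSpace F] [IsNonarchimedeanLocalField F]
  [MeasurableSpace F] [BorelSpace F] (μ : Measure F) [μ.IsAddHaarMeasure] [Invertible (2 : F)] {ι : Type} [Fintype ι]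
  {ψ : AddChar F Circle} (hψ : ψ.IsContinuousNontrivial)

include hψ in
/-- **GENERIC CLOSER.**  `ψ` a continuous non-trivial additive character of the local field `F`, `μ` a Haar measure, `g ∈ 𝒮(F^ι)`, `a` a linear
automorphism, `c` a linear map (the quadratic form `q = halfForm c`), `γ, β′` scalars, `C k` compact open subgroups increasing and exhausting `F`, and
`V : F → ℂ` ANY function with the word `V b = γ · ∫ x, (leviOpPi a (unipOpPi (b • c) g))(x) dμ^ι` for all `b`.  If `halfForm c y ≠ β′` for every
`y ∈ tsupport g`, then `∫_{b ∈ C k} V(b)·ψ(β′ b) dμ = 0` for all large `k` (★ W1-fin-a at `Φ̃ = |det a|^{−1∕2}·g∘a⁻¹`, `θ_x = ψ((β′ − q(a⁻¹x))·)`).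
[cite: KudlaRallis1994, §2] [cite: MoeglinVignerasWaldspurger1987, Chap. 2 II.6] [cite: Rangarao1993, Lemma 3.2 (3.8)] -/
theorem exists_forall_setIntegral_word_mul_addChar_eq_zero (g : SchwartzBruhat (ι → F)) (a : (ι → F) ≃ₗ[F] (ι → F))
    (c : (ι → F) →ₗ[F] (ι → F)) (γ : ℂ) (β' : F) (V : F → ℂ)
    (hV : ∀ b : F, V b = γ * ∫ x, ((leviOpPi a (unipOpPi (isLocallyConstant_of_isContinuousNontrivial hψ) (b • c) g) :
      SchwartzBruhat (ι → F)) : (ι → F) → ℂ) x ∂(Measure.pi fun _ : ι => μ))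
    (Cs : ℕ → AddSubgroup F) (hCo : ∀ k, IsOpen (Cs k : Set F)) (hCc : ∀ k, IsCompact (Cs k : Set F)) (hmono : Monotone Cs)
    (hexh : ∀ t, ∃ k, t ∈ Cs k) (hg : ∀ y ∈ tsupport ((g : SchwartzBruhat (ι → F)) : (ι → F) → ℂ), halfForm c y ≠ β') :
    ∃ k₀ : ℕ, ∀ k, k₀ ≤ k → ∫ b in (Cs k : Set F), V b * ((ψ (β' * b) : Circle) : ℂ) ∂μ = 0 := by
  haveI : SecondCountableTopology F := secondCountableTopology_localField F
  -- the pulled-back test function, quadratic form and oscillatory kernel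
  set e : (ι → F) ≃ₜ (ι → F) :=
    { toEquiv := a.symm.toEquiv
      continuous_toFun := a.symm.toLinearMap.continuous_on_pi
      continuous_invFun := a.toLinearMap.continuous_on_pi } with he
  have hea : ∀ x, e x = a.symm x := fun _ => rfl
  set gf : (ι → F) → ℂ := ((g : SchwartzBruhat (ι → F)) : (ι → F) → ℂ) with hgf
  set Φt : (ι → F) → ℂ := fun x => ((modSqrt a : ℂ))⁻¹ * gf (a.symm x) with hΦt
  set q : (ι → F) → F := fun x => halfForm c (a.symm x) with hq
  set θ : (ι → F) → AddChar F Circle := fun x => ψ.mulShift (β' - q x) with hθ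
  have hgc : Continuous gf := g.2.1.continuous
  have hac : Continuous a.symm := a.symm.toLinearMap.continuous_on_pi
  have hqc : Continuous q := (continuous_halfForm c).comp hac
  have hΦtc : Continuous Φt := continuous_const.mul (hgc.comp hac)
  have hΦts : HasCompactSupport Φt := by
    have h1 : HasCompactSupport (gf ∘ e) := g.2.2.comp_homeomorph e
    exact h1.mul_left
  have hΦti : Integrable Φt (Measure.pi fun _ : ι => μ) := hΦtc.integrable_of_hasCompactSupport hΦts
  have hθm : Measurable fun p : F × (ι → F) => ((θ p.2 p.1 : Circle) : ℂ) := by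
    refine (continuous_subtype_val.comp (hψ.1.comp ?_)).measurable
    exact (continuous_const.sub (hqc.comp continuous_snd)).mul continuous_fst
  have hθc : ∀ t, Continuous fun x => ((θ x t : Circle) : ℂ) := fun t =>
    continuous_subtype_val.comp (hψ.1.comp ((continuous_const.sub hqc).mul continuous_const))
  -- non-triviality of `θ_x` on the support: `q x ≠ β′` there
  have hnt : ∀ x ∈ tsupport Φt, ∃ t, ((θ x t : Circle) : ℂ) ≠ 1 := by
    intro x hx
    have hx1 : x ∈ tsupport (gf ∘ e) := tsupport_mul_subset_right hx
    rw [tsupport_comp_eq_preimage gf e, mem_preimage, hea] at hx1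
    have hne : β' - q x ≠ 0 := sub_ne_zero.2 (Ne.symm (hg _ hx1))
    obtain ⟨z, hz⟩ := AddChar.ne_zero_iff.1 hψ.2
    refine ⟨(β' - q x)⁻¹ * z, fun h => hz ?_⟩
    rw [hθ, AddChar.mulShift_apply, mul_inv_cancel_left₀ hne] at h
    exact Circle.coe_eq_one.1 h
  -- the word, rewritten as a ball-averaged oscillatory integral
  have key : ∀ b : F, V b * ((ψ (β' * b) : Circle) : ℂ) = γ * ∫ x, Φt x * ((θ x b : Circle) : ℂ) ∂(Measure.pi fun _ : ι => μ) := by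
    intro b
    rw [hV b, mul_assoc, ← integral_mul_const]
    congr 1
    refine integral_congr_ae (Eventually.of_forall fun x => ?_)
    have hθval : ((θ x b : Circle) : ℂ) = ((ψ (-halfForm (b • c) (a.symm x)) : Circle) : ℂ) * ((ψ (β' * b) : Circle) : ℂ) := by
      show ((ψ.mulShift (β' - halfForm c (a.symm x)) b : Circle) : ℂ) = _
      rw [AddChar.mulShift_apply, ← Circle.coe_mul, ← AddChar.map_add_eq_mul, halfForm_apply, halfForm_apply, LinearMap.smul_apply,
        dotProduct_smul, smul_eq_mul]
      congr 2
      ring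
    dsimp only
    rw [coe_leviOpPi_apply, coe_unipOpPi_apply, hθval]
    simp only [hΦt, hgf]
    ring
  obtain ⟨k₀, hk₀⟩ := exists_forall_setIntegral_integral_mul_addChar_eq_zero μ (Measure.pi fun _ : ι => μ) hΦti hΦts θ hθm hθc Cs hCo hCc hmono hexh hnt
  refine ⟨k₀, fun k hk => ?_⟩
  rw [setIntegral_congr_fun (hCo k).measurableSet fun b _ => key b, integral_const_mul, hk₀ k hk, mul_zero]

end Generic

/-! ## §2 The closer at the twisted section of the standard doubled line (★ W1-fin-b) -/

section CM

variable (L : Type) [Field L] [NumberField L] [IsCMField L] (v : HeightOneSpectrum (𝓞 (maximalRealSubfield L)))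
  [MeasurableSpace (v.adicCompletion (maximalRealSubfield L))] [BorelSpace (v.adicCompletion (maximalRealSubfield L))]
  (μ : Measure (v.adicCompletion (maximalRealSubfield L))) [μ.IsAddHaarMeasure]
  {T : Matrix (Fin (1 + 1)) (Fin (1 + 1)) (maximalRealSubfield L)} (hTs : T.IsSymm) (hTd : IsUnit T.det)
  (χ : HeckeCharacter L) (hχ : IsSplittingChar L 1 χ)
  {JD₁ : Matrix (Fin (1 + 1)) (Fin (1 + 1)) L}
  (hJD₁ : JD₁ = (gramD (maximalRealSubfield L) 1 1).map (algebraMap (maximalRealSubfield L) L))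
  (hTv : IsUnit (localGram (maximalRealSubfield L) (2 + 2) (gramD (maximalRealSubfield L) 2 T) v).det)

include hTd hTv in
set_option synthInstance.maxHeartbeats 400000 in
set_option maxHeartbeats 4000000 in -- the doubled CM datum's telescope (as ★ (BR-N), (BR-W), (OPW), W1-fin-b)
/-- **S5-W1-fin — THE LOCAL SW WHITTAKER VALUE OF A LINE DIES OFF THE ORBIT.**  Data of ★ W1-fin-b (`E″`, `hE″`, `Γ`, `hΓ`, `B′`, `hW`, `m`, `τ`):
for compact open subgroups `C k ↑ L⁺_v`, a Whittaker parameter `β′` and a test vector `Ψ` such that the quadratic form `halfForm c_τ` does NOT take the value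
`β′` on `tsupport (ΓΨ)`, the ball-averaged twisted Whittaker value of the line's local SW section vanishes for all large `k`:
  `∫_{b ∈ C k} (Γ(σ(w₁ · n(b·τ))Ψ))(0) · ψ_v(β′ b) dμ(b) = 0`.
[cite: KudlaRallis1994, §2] [cite: MoeglinVignerasWaldspurger1987, Chap. 2 II.6] [cite: JiangWu2016ChiB, Prop. 4.1] -/
theorem exists_forall_setIntegral_valueAtZero_mul_addChar_eq_zero
    (E'' : LocalSp (maximalRealSubfield L) (2 + 2) (gramD (maximalRealSubfield L) 2 T) v)
    (hE'' : (deltaLagrangian (maximalRealSubfield L) v 2).map (toLin (maximalRealSubfield L) v E'') =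
      lagrangianY (maximalRealSubfield L) (2 + 2) v)
    (Γ : SchwartzBruhat (Fin (2 + 2) → v.adicCompletion (maximalRealSubfield L)) ≃ₗ[ℂ] SchwartzBruhat (Fin (2 + 2) → v.adicCompletion (maximalRealSubfield L)))
    (hΓ : Implements (localSchrodinger (maximalRealSubfield L) (2 + 2) (gramD (maximalRealSubfield L) 2 T) v) (ofSymplectic _ E'') Γ)
    (B' : GL (Fin (2 + 2)) (v.adicCompletion (maximalRealSubfield L)))
    (hW : E'' * iotaD (maximalRealSubfield L) L (IsCMField.complexConj L) (complexConj_imagUnit L) (imagUnit_ne_zero L)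
        (imagUnit_mul_self L) v 2 hTs rfl (weylDelta (maximalRealSubfield L) L (IsCMField.complexConj L) v 2 (T₀ := T) rfl) * E''⁻¹ =
      (transportSp (localGram (maximalRealSubfield L) (2 + 2) (gramD (maximalRealSubfield L) 2 T) v) hTv (SymplecticGroup.symJ _ _))⁻¹ *
        transportSp (localGram (maximalRealSubfield L) (2 + 2) (gramD (maximalRealSubfield L) 2 T) v) hTv (levi B'))
    {m : ℤ} (hm : (adeleAddCharAt (maximalRealSubfield L) v).HasConductorExp m)
    (τ : LocalRing L v) (hτ : conjLocal L (IsCMField.complexConj L) v τ = -τ)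
    (Cs : ℕ → AddSubgroup (v.adicCompletion (maximalRealSubfield L))) (hCo : ∀ k, IsOpen (Cs k : Set (v.adicCompletion (maximalRealSubfield L))))
    (hCc : ∀ k, IsCompact (Cs k : Set (v.adicCompletion (maximalRealSubfield L)))) (hmono : Monotone Cs) (hexh : ∀ t, ∃ k, t ∈ Cs k)
    (β' : v.adicCompletion (maximalRealSubfield L)) (Ψ : SchwartzBruhat (Fin (2 + 2) → v.adicCompletion (maximalRealSubfield L)))
    (hΨ : ∀ y ∈ tsupport (((Γ Ψ : SchwartzBruhat (Fin (2 + 2) → v.adicCompletion (maximalRealSubfield L)))) : (Fin (2 + 2) → v.adicCompletion (maximalRealSubfield L)) → ℂ),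
      halfForm (Matrix.mulVecLin (cOfFix (localGram (maximalRealSubfield L) (2 + 2) (gramD (maximalRealSubfield L) 2 T) v) (E'' * iotaD (maximalRealSubfield L) L (IsCMField.complexConj L) (complexConj_imagUnit L) (imagUnit_ne_zero L) (imagUnit_mul_self L) v 2 hTs rfl (nElem (maximalRealSubfield L) L (IsCMField.complexConj L) v 2 (T₀ := T) rfl (τ • 1) (skew_smul_one (maximalRealSubfield L) L (IsCMField.complexConj L) v 2 τ hτ)) * E''⁻¹))) y ≠ β') :
    ∃ k₀ : ℕ, ∀ k, k₀ ≤ k →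
      ∫ b in (Cs k : Set (v.adicCompletion (maximalRealSubfield L))),
        ((Γ ((((localMu L χ v (Matrix.GeneralLinearGroup.det ((localPiEquiv L (IsCMField.complexConj L) (1 + 1) JD₁ v ((weylDelta (maximalRealSubfield L) L (IsCMField.complexConj L) v 1 hJD₁) * (nElem (maximalRealSubfield L) L (IsCMField.complexConj L) v 1 hJD₁ ((b • τ) • 1) (skew_smul_one (maximalRealSubfield L) L (IsCMField.complexConj L) v 1 (b • τ) (skew_smul L v b τ hτ))))).1)))⁻¹ : ℂˣ) : ℂ) •
            MpPsi.toRep (localSchrodinger (maximalRealSubfield L) (2 + 2) (gramD (maximalRealSubfield L) 2 T) v)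
              ((localSplittingDatumCM L v μ 2 hTs hTd rfl χ hχ).localSplitting ((kronLoc (maximalRealSubfield L) L (IsCMField.complexConj L) v 2 (T := T) (J := T.map (algebraMap (maximalRealSubfield L) L)) rfl rfl hJD₁) ((weylDelta (maximalRealSubfield L) L (IsCMField.complexConj L) v 1 hJD₁) * (nElem (maximalRealSubfield L) L (IsCMField.complexConj L) v 1 hJD₁ ((b • τ) • 1) (skew_smul_one (maximalRealSubfield L) L (IsCMField.complexConj L) v 1 (b • τ) (skew_smul L v b τ hτ)))))) Ψ) : SchwartzBruhat (Fin (2 + 2) → v.adicCompletion (maximalRealSubfield L))) : (Fin (2 + 2) → v.adicCompletion (maximalRealSubfield L)) → ℂ) 0 *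
          (((adeleAddCharAt (maximalRealSubfield L) v) (β' * b) : Circle) : ℂ) ∂μ = 0 := by
  obtain ⟨γ, hγ⟩ := exists_twistedSection_weylDelta_mul_nElem_smul_apply_zero L v μ hTs hTd χ hχ hJD₁ hTv E'' hE'' Γ hΓ B' hW hm τ hτ
  exact exists_forall_setIntegral_word_mul_addChar_eq_zero μ (isContinuousNontrivial_adeleAddCharAt (maximalRealSubfield L) v) (Γ Ψ) (glEquiv B')
    (Matrix.mulVecLin (cOfFix (localGram (maximalRealSubfield L) (2 + 2) (gramD (maximalRealSubfield L) 2 T) v) (E'' * iotaD (maximalRealSubfield L) L (IsCMField.complexConj L) (complexConj_imagUnit L) (imagUnit_ne_zero L) (imagUnit_mul_self L) v 2 hTs rfl (nElem (maximalRealSubfield L) L (IsCMField.complexConj L) v 2 (T₀ := T) rfl (τ • 1) (skew_smul_one (maximalRealSubfield L) L (IsCMField.complexConj L) v 2 τ hτ)) * E''⁻¹))) γ β' _ (fun b => hγ b Ψ) Cs hCo hCc hmono hexh hΨ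

end CM

end Summit.HodgeConjecture.HodgeConjecture.Cruxes.HLiu418.K2LiuRankOneLocalSWWhittakerVanishing

end
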